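import Summits.ResolutionOfSingularities.ResolutionOfSingularities.Theorems.FrobeniusLadderFRationalResolutionBlowupRegularLocalization
import HarnessLib

/-!
# Crux `FrobeniusLadder.FRationalResolution` (stmt-ResolutionOfSingularities-15317), line `redirect`,
# stub `stub_diagonalizableQuotientResolution` — NAIVE RECIPE FROM A TORIC (OR ANY ALGEBRAIC) MODEL OF `Ê`

The class-group-free settlement of a twisted isolated point (`…MaximalIdealTower.hloc_of_isRegular_affineBlowup_maximalIdealPow`, p839495, `a = 0`) asks
for `Bl_{𝔪̂}(Spec Ê)` regular. If `Ê` is identified, as a ring, with the completed local ring `(T_𝔳)^` of ANY algebra `T` of finite type over a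
field at a maximal ideal `𝔳` (the toric model `T = κ[P]` at its vertex: Kato (3.2) for both sides), then regularity of the global blow-up
`Bl_𝔳(Spec T)` — a chart computation, cf. `veroneseCone_isRegular_affineBlowup`, `segreCone_isRegular_affineBlowup` — suffices:

* ★ `isRegular_affineBlowup_maximalIdeal_of_ringEquiv_model` — `Bl_𝔳(Spec T)` regular, `e : (T_𝔳)^ ≃+* E` ⇒ `Bl_{𝔪_E}(Spec E)` regular
  (localisation p840394, G-ring ascent p838626, transport along `e`);
* ★★★ `hloc_of_ringEquiv_model` — Galois data + `e : (T_𝔳)^ ≃+* Ê` + `Bl_𝔳(Spec T)` regular ⇒ `hloc` at the twisted point.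

So for the 68 + 20·∞ classes whose vertex blow-up is already regular (all twisted Veronese cones `V(n,r)`, `1/3(1,1,2)`, `1/7(1,2,4)`, …; fan probe
of g17) the ONLY remaining input is the ring isomorphism `Ê ≅ (κ'[P]_𝔳)^` (both sides `≅ κ'⟦P⟧` by Kato (3.2)). Honest label: plumbing toward ONE leaf
stub (no stub, crux or summit closed). No definitions, no named facts, no sorry.
[cite: Matsumura1987, Thm. 8.11; Thm. 8.14; §32 p. 256] [cite: StacksProject, Tag 07PT; Tag 0C4G] [cite: Kato1994, Thm. (3.2)]
-/

noncomputable section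

-- single-problem summit: the doubled namespace component is forced
set_option linter.dupNamespace false

open CategoryTheory AlgebraicGeometry TopologicalSpace IsLocalRing TensorProduct
open Literature.AlgebraicGeometry.Resolution
open Summit.ResolutionOfSingularities.ResolutionOfSingularities.Theorems.FRationalResolution

namespace Summit.ResolutionOfSingularities.ResolutionOfSingularities.Theorems.FRationalResolution.ToricModelTransfer

/-- ★ **`Bl_𝔪` regularity from an algebraic model of the completion.** `T` of finite type over a field `κ`, `𝔳` maximal with `Bl_𝔳(Spec T)` regular,
`E` a local ring with `e : (T_𝔳)^ ≃+* E`: then `Bl_{𝔪_E}(Spec E)` is regular. [cite: Matsumura1987, §32 p. 256] [cite: StacksProject, Tag 07PT] -/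
theorem isRegular_affineBlowup_maximalIdeal_of_ringEquiv_model (κ : Type) [Field κ] {T : Type} [CommRing T] [Algebra κ T]
    [Algebra.FiniteType κ T] (𝔳 : Ideal T) [h𝔳 : 𝔳.IsMaximal] (hreg : Scheme.IsRegular (affineBlowup 𝔳))
    {E : Type} [CommRing E] [IsLocalRing E]
    (e : AdicCompletion (maximalIdeal (Localization.AtPrime 𝔳)) (Localization.AtPrime 𝔳) ≃+* E) :
    Scheme.IsRegular (affineBlowup (maximalIdeal E)) := by
  have hT : IsGRing T := Matsumura1987_32_6_cor_holds.{0} κ T ‹_›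
  haveI : IsNoetherianRing T := hT.1
  haveI : IsNoetherianRing (Localization.AtPrime 𝔳) :=
    IsLocalization.isNoetherianRing 𝔳.primeCompl (Localization.AtPrime 𝔳) inferInstance
  -- localise, then ascend to the completion
  have h1 := BlowupRegularLocalization.isRegular_affineBlowup_atPrime 𝔳 𝔳 hreg
  have h2 := BlowupRegularCompletionAscent.isRegular_affineBlowup_adicCompletion_of_isGRing hT 𝔳 𝔳 h1
  rw [Localization.AtPrime.map_eq_maximalIdeal, ← AdicCompletion.maximalIdeal_eq_map] at h2
  -- transport along `e`
  have h3 := BlowupOrbitCentre.isRegular_affineBlowup_map_of_ringEquiv e _ h2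
  rwa [PointBlowupOfCompletion.map_maximalIdeal_ringEquiv e] at h3

/-- ★★★ **THE NAIVE RECIPE FROM AN ALGEBRAIC MODEL.** Galois data as in p839495; if `Ê = ((B ⊗_K K')_{𝔔'})^` is isomorphic AS A RING to `(T_𝔳)^` for some
algebra `T` of finite type over a field `κ` and maximal `𝔳` with `Bl_𝔳(Spec T)` regular, then `hloc` holds at the twisted point.
[cite: Matsumura1987, Thm. 8.11; Thm. 8.14; §32 p. 256] [cite: StacksProject, Tag 0CDQ; Tag 09EB; Tag 07PT] [cite: Kato1994, Thm. (3.2)] -/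
theorem hloc_of_ringEquiv_model (K : Type) [Field K] (X : Scheme.{0}) [IsIntegral X]
    (f : X ⟶ Spec (.of K)) [LocallyOfFiniteType f]
    {B : Type} [CommRing B] [IsDomain B] [Algebra K B] [Algebra.FiniteType K B]
    (ι : Spec (.of B) ⟶ X) [IsOpenImmersion ι] (hι : ι ≫ f = Spec.map (CommRingCat.ofHom (algebraMap K B)))
    (𝔭 : Ideal B) [h𝔭 : 𝔭.IsMaximal] (h𝔭0 : 𝔭 ≠ ⊥)
    (hsing : ι ⟨𝔭, h𝔭.isPrime⟩ ∉ Scheme.regularLocus X)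
    (hregB : ∀ P : Spec (.of B), P.asIdeal ≠ 𝔭 → P ∈ Scheme.regularLocus (Spec (.of B)))
    (K' : Type) [Field K'] [Algebra K K'] [FiniteDimensional K K'] [IsGalois K K']
    (𝔔' : Ideal (B ⊗[K] K')) [h𝔔' : 𝔔'.IsMaximal] (h𝔔'𝔭 : 𝔔'.comap (algebraMap B (B ⊗[K] K')) = 𝔭)
    (κ : Type) [Field κ] {T : Type} [CommRing T] [Algebra κ T] [Algebra.FiniteType κ T] (𝔳 : Ideal T) [h𝔳 : 𝔳.IsMaximal]
    (hreg : Scheme.IsRegular (affineBlowup 𝔳))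
    (e : AdicCompletion (maximalIdeal (Localization.AtPrime 𝔳)) (Localization.AtPrime 𝔳) ≃+*
      AdicCompletion (maximalIdeal (Localization.AtPrime 𝔔')) (Localization.AtPrime 𝔔')) :
    ∃ (V : X.Opens), ι ⟨𝔭, h𝔭.isPrime⟩ ∈ V ∧
      (∀ t : X, t ∉ Scheme.regularLocus X → t ∈ V → t = ι ⟨𝔭, h𝔭.isPrime⟩) ∧
      ∃ (Y : Scheme.{0}) (ρ : Y ⟶ V), IsProper ρ ∧ Scheme.IsRegular Y ∧
        IsIso (ρ ∣_ (V.ι ⁻¹ᵁ ⟨Scheme.regularLocus X, isOpen_regularLocus_of_locallyOfFiniteType_field f⟩)) ∧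
        Dense ((ρ ⁻¹ᵁ (V.ι ⁻¹ᵁ ⟨Scheme.regularLocus X,
          isOpen_regularLocus_of_locallyOfFiniteType_field f⟩) : Y.Opens) : Set Y) := by
  haveI : IsNoetherianRing B := Algebra.FiniteType.isNoetherianRing K B
  haveI : Algebra.FiniteType B (B ⊗[K] K') := inferInstance
  haveI : IsNoetherianRing (B ⊗[K] K') := Algebra.FiniteType.isNoetherianRing B (B ⊗[K] K')
  haveI : IsNoetherianRing (Localization.AtPrime 𝔔') :=
    IsLocalization.isNoetherianRing 𝔔'.primeCompl (Localization.AtPrime 𝔔') inferInstance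
  set Ê := AdicCompletion (maximalIdeal (Localization.AtPrime 𝔔')) (Localization.AtPrime 𝔔') with hÊ
  have hfac : algebraMap (B ⊗[K] K') Ê =
      (algebraMap (Localization.AtPrime 𝔔') Ê).comp (algebraMap (B ⊗[K] K') (Localization.AtPrime 𝔔')) :=
    RingHom.ext fun _ => rfl
  have hmapQ : 𝔔'.map (algebraMap (B ⊗[K] K') Ê) = maximalIdeal Ê := by
    rw [hfac, ← Ideal.map_map, Localization.AtPrime.map_eq_maximalIdeal, ← AdicCompletion.maximalIdeal_eq_map]
  have h := isRegular_affineBlowup_maximalIdeal_of_ringEquiv_model κ 𝔳 hreg e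
  rw [← hmapQ, ← pow_one (𝔔'.map _)] at h
  exact MaximalIdealTower.hloc_of_isRegular_affineBlowup_maximalIdealPow K X f ι hι 𝔭 h𝔭0 hsing hregB K' 𝔔' h𝔔'𝔭 0 h

end Summit.ResolutionOfSingularities.ResolutionOfSingularities.Theorems.FRationalResolution.ToricModelTransfer

end
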